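import Mathlib.Algebra.BigOperators.Group.Finset.Basic
import Mathlib.Algebra.Order.BigOperators.Group.Finset
import Mathlib.Data.Fintype.BigOperators
import Mathlib.Tactic
import HarnessLib
import Summits.Ventures.HSemireg.TriangleFreeBoxMargins

/-!
# Venture HSemireg — kernel leg of THEOREM L″ (W5 seat w5-n6-2 gen 17): the master box inequality for four-coordinate designs with arbitrary level-uniform margins and triangles
Bookkeeping of the computation cell `pub-hsemireg`, group W5 (note `widen/W5/FLATTF-w5n62g17.md` §10,
scripts `widen/W5/n6code2/v20/flattf/`). Setting: four level types `α β γ δ` (coordinates `A B C D`), the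
six torus graphs as neighbourhood maps `nXY` with transposes (`cXY`), LEVEL-UNIFORM MARGINS
`μX : X → ℕ` (`#(nXY x) = μX x` for every other coordinate `Y`; `Σ_x μX x = m` is assumed where the proof uses
it — at `A`, `C`, `D`; at `B` it follows but is not needed). Triangles allowed.
Every count is an explicit sum from a level `a ∈ A` (EDGE-SUBSET counts over transversals, N7F §3.8 (a)):
`N₁, N₂, N₃` the transversal 4-cycles of the three cyclic orders; `B_XY = Σ_{tori} μX·μY`; `F^{XY}` the
transversals carrying the five tori other than `{X,Y}`; `K₄`; and the twelve margin-weighted triangle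
counts `P^V_{XYZ}` (triangles on the triple `XYZ`, each weighted by the margin of its vertex in `V`),
whose sum is the `Paw` term of §3.8 (a).
* `box_bound_overlap_margins` — one torus, general margins, overlapping halves (LEMMA 2 + inclusion–exclusion);
* `box_master_inequality` — **THEOREM L″** (inequality form): `2 ΣB + 2 ΣF₅ ≤ 2 ΣN(C₄) + 3 m² + ΣPaw + 3 N(K₄)`.
Special cases (in the note): triangle-free ⇒ `TriangleFreeBoxMargins.lean`; flat ⇒ `FlatFourCoordinateBoxes.lean`.
HONEST FRAMING: finite combinatorics only; the identification with the cell's K-secant coordinate skeleta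
and the |S| = 4 class equation lives in the notes. Nothing in this file says that HC, HC_CM or HC_AV holds.
-/

namespace Summit.Ventures.HSemireg

namespace FourCoordinateBoxMaster
open Finset
open FlatTriangleFreeFourCycles (sum_card_inter_comm)
open FlatFourCoordinateBoxes (sum_inter_comm)
open TriangleFreeBoxMargins (edge_sum_comm B_symm)

section Box
variable {Y W : Type*} [Fintype W] [DecidableEq Y] [DecidableEq W]

/-- **Box count, general margins, overlapping halves.** In a bipartite graph `Y – W` with degrees `μY`,
`μW` (`Σ_w μW w = m`), for any `S₁, S₂ ⊆ Y`, `K₁, K₂ ⊆ W`: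
`μ(S₁)+μ(S₂)+μ(K₁)+μ(K₂) + e(S₁,K₁∩K₂) + e(S₂,K₁∩K₂) + e(S₁∩S₂,K₁) + e(S₁∩S₂,K₂)
 ≤ e(S₂,K₁) + e(S₁,K₂) + e(S₁,K₁) + e(S₂,K₂) + e(S₁∩S₂,K₁∩K₂) + μ(S₁∩S₂) + μ(K₁∩K₂) + m`. -/
theorem box_bound_overlap_margins (m : ℕ) (μY : Y → ℕ) (μW : W → ℕ)
    (nYW : Y → Finset W) (nWY : W → Finset Y) (hc : ∀ y w, w ∈ nYW y ↔ y ∈ nWY w)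
    (hY : ∀ y, (nYW y).card = μY y) (hWd : ∀ w, (nWY w).card = μW w) (hm : ∑ w, μW w = m)
    (S₁ S₂ : Finset Y) (K₁ K₂ : Finset W) :
    (∑ y ∈ S₁, μY y) + (∑ y ∈ S₂, μY y) + (∑ w ∈ K₁, μW w) + (∑ w ∈ K₂, μW w)
        + (∑ y ∈ S₁, (nYW y ∩ (K₁ ∩ K₂)).card) + (∑ y ∈ S₂, (nYW y ∩ (K₁ ∩ K₂)).card)
        + (∑ y ∈ S₁ ∩ S₂, (nYW y ∩ K₁).card) + (∑ y ∈ S₁ ∩ S₂, (nYW y ∩ K₂).card)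
      ≤ (∑ y ∈ S₂, (nYW y ∩ K₁).card) + (∑ y ∈ S₁, (nYW y ∩ K₂).card)
        + (∑ y ∈ S₁, (nYW y ∩ K₁).card) + (∑ y ∈ S₂, (nYW y ∩ K₂).card)
        + (∑ y ∈ S₁ ∩ S₂, (nYW y ∩ (K₁ ∩ K₂)).card)
        + (∑ y ∈ S₁ ∩ S₂, μY y) + (∑ w ∈ K₁ ∩ K₂, μW w) + m := by
  classical
  set K : Finset W := K₁ ∪ K₂ with hK
  set R : Finset W := univ \ K with hR
  have row : ∀ y, (nYW y ∩ K₁).card + (nYW y ∩ K₂).card + (nYW y ∩ R).card = μY y + (nYW y ∩ (K₁ ∩ K₂)).card := by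
    intro y
    have h1 : (nYW y ∩ K).card + (nYW y ∩ R).card = μY y := by
      have e1 : nYW y ∩ R = nYW y \ K := by ext w; simp only [hR, mem_inter, mem_sdiff, mem_univ, true_and]
      rw [e1, Finset.card_inter_add_card_sdiff, hY y]
    have h2 : (nYW y ∩ K₁).card + (nYW y ∩ K₂).card = (nYW y ∩ K).card + (nYW y ∩ (K₁ ∩ K₂)).card := by
      have e2 : nYW y ∩ K = (nYW y ∩ K₁) ∪ (nYW y ∩ K₂) := by rw [hK]; exact Finset.inter_union_distrib_left _ _ _
      have e3 : nYW y ∩ (K₁ ∩ K₂) = (nYW y ∩ K₁) ∩ (nYW y ∩ K₂) := by ext w; simp only [mem_inter]; tauto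
      rw [e2, e3, Finset.card_union_add_card_inter]
    omega
  have sum₁ : (∑ y ∈ S₁, (nYW y ∩ K₁).card) + (∑ y ∈ S₁, (nYW y ∩ K₂).card) + (∑ y ∈ S₁, (nYW y ∩ R).card)
      = (∑ y ∈ S₁, μY y) + ∑ y ∈ S₁, (nYW y ∩ (K₁ ∩ K₂)).card := by
    rw [← Finset.sum_add_distrib, ← Finset.sum_add_distrib, Finset.sum_congr rfl (fun y _ => row y), Finset.sum_add_distrib]
  have sum₂ : (∑ y ∈ S₂, (nYW y ∩ K₁).card) + (∑ y ∈ S₂, (nYW y ∩ K₂).card) + (∑ y ∈ S₂, (nYW y ∩ R).card)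
      = (∑ y ∈ S₂, μY y) + ∑ y ∈ S₂, (nYW y ∩ (K₁ ∩ K₂)).card := by
    rw [← Finset.sum_add_distrib, ← Finset.sum_add_distrib, Finset.sum_congr rfl (fun y _ => row y), Finset.sum_add_distrib]
  have sum₀ : (∑ y ∈ S₁ ∩ S₂, (nYW y ∩ K₁).card) + (∑ y ∈ S₁ ∩ S₂, (nYW y ∩ K₂).card) + (∑ y ∈ S₁ ∩ S₂, (nYW y ∩ R).card)
      = (∑ y ∈ S₁ ∩ S₂, μY y) + ∑ y ∈ S₁ ∩ S₂, (nYW y ∩ (K₁ ∩ K₂)).card := by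
    rw [← Finset.sum_add_distrib, ← Finset.sum_add_distrib, Finset.sum_congr rfl (fun y _ => row y), Finset.sum_add_distrib]
  have rest : (∑ y ∈ S₁, (nYW y ∩ R).card) + (∑ y ∈ S₂, (nYW y ∩ R).card) ≤ (∑ w ∈ R, μW w) + ∑ y ∈ S₁ ∩ S₂, (nYW y ∩ R).card := by
    have hui : (∑ y ∈ S₁ ∪ S₂, (nYW y ∩ R).card) + (∑ y ∈ S₁ ∩ S₂, (nYW y ∩ R).card)
        = (∑ y ∈ S₁, (nYW y ∩ R).card) + (∑ y ∈ S₂, (nYW y ∩ R).card) := Finset.sum_union_inter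
    have hle : ∑ y ∈ S₁ ∪ S₂, (nYW y ∩ R).card ≤ ∑ w ∈ R, μW w := by
      calc ∑ y ∈ S₁ ∪ S₂, (nYW y ∩ R).card ≤ ∑ y ∈ (S₁ ∪ S₂) ∪ (R.biUnion nWY), (nYW y ∩ R).card :=
            Finset.sum_le_sum_of_subset (Finset.subset_union_left)
        _ = ∑ w ∈ R, (nWY w ∩ ((S₁ ∪ S₂) ∪ (R.biUnion nWY))).card := sum_card_inter_comm _ _ nYW nWY hc
        _ = ∑ w ∈ R, μW w := by
            refine Finset.sum_congr rfl (fun w hw => ?_)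
            have hsub : nWY w ⊆ (S₁ ∪ S₂) ∪ (R.biUnion nWY) := fun y hy => Finset.mem_union_right _ (Finset.mem_biUnion.mpr ⟨w, hw, hy⟩)
            rw [Finset.inter_eq_left.mpr hsub, hWd w]
    omega
  have splitW : (∑ w ∈ K, μW w) + (∑ w ∈ R, μW w) = m := by
    have hKR : Disjoint K R := by rw [hR]; exact Finset.disjoint_sdiff
    have huniv : K ∪ R = univ := by rw [hR]; exact Finset.union_sdiff_of_subset (Finset.subset_univ _)
    rw [← Finset.sum_union hKR, huniv, hm]
  have splitK : (∑ w ∈ K, μW w) + (∑ w ∈ K₁ ∩ K₂, μW w) = (∑ w ∈ K₁, μW w) + (∑ w ∈ K₂, μW w) := by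
    rw [hK]; exact Finset.sum_union_inter
  omega

end Box

section Design
variable {α β γ δ : Type*} [Fintype α] [Fintype β] [Fintype γ] [Fintype δ]
  [DecidableEq α] [DecidableEq β] [DecidableEq γ] [DecidableEq δ]

/-- **THEOREM L″** (FLATTF-w5n62g17 §10, inequality form): for every four-coordinate design with level-uniform
margins, `2 ΣB + 2 ΣF₅ ≤ 2 ΣN(C₄) + 3 m² + ΣPaw + 3 N(K₄)`, every count written as an explicit sum from a
level `a ∈ A` (dictionary in the module docstring; the twelve `P` terms are listed triple by triple). -/
theorem box_master_inequality (m : ℕ) (μA : α → ℕ) (μB : β → ℕ) (μC : γ → ℕ) (μD : δ → ℕ)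
    (mA : ∑ a, μA a = m) (mC : ∑ c, μC c = m) (mD : ∑ e, μD e = m)
    (nAB : α → Finset β) (nBA : β → Finset α) (nAC : α → Finset γ) (nCA : γ → Finset α) (nAD : α → Finset δ) (nDA : δ → Finset α)
    (nBC : β → Finset γ) (nCB : γ → Finset β) (nBD : β → Finset δ) (nDB : δ → Finset β) (nCD : γ → Finset δ) (nDC : δ → Finset γ)
    (cAB : ∀ a b, b ∈ nAB a ↔ a ∈ nBA b) (cAC : ∀ a c, c ∈ nAC a ↔ a ∈ nCA c) (cAD : ∀ a e, e ∈ nAD a ↔ a ∈ nDA e)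
    (cBC : ∀ b c, c ∈ nBC b ↔ b ∈ nCB c) (cBD : ∀ b e, e ∈ nBD b ↔ b ∈ nDB e) (cCD : ∀ c e, e ∈ nCD c ↔ c ∈ nDC e)
    (rAB : ∀ a, (nAB a).card = μA a) (rBA : ∀ b, (nBA b).card = μB b) (rAC : ∀ a, (nAC a).card = μA a) (rCA : ∀ c, (nCA c).card = μC c)
    (rAD : ∀ a, (nAD a).card = μA a) (rDA : ∀ e, (nDA e).card = μD e) (rBC : ∀ b, (nBC b).card = μB b) (rCB : ∀ c, (nCB c).card = μC c)
    (rBD : ∀ b, (nBD b).card = μB b) (rDB : ∀ e, (nDB e).card = μD e) (rCD : ∀ c, (nCD c).card = μC c) (rDC : ∀ e, (nDC e).card = μD e) :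
    2 * ((∑ a, μA a * ∑ b ∈ nAB a, μB b) + (∑ a, μA a * ∑ c ∈ nAC a, μC c) + (∑ a, μA a * ∑ e ∈ nAD a, μD e)
         + (∑ b, μB b * ∑ c ∈ nBC b, μC c) + (∑ b, μB b * ∑ e ∈ nBD b, μD e) + (∑ c, μC c * ∑ e ∈ nCD c, μD e))
      + 2 * ((∑ a, ∑ c ∈ nAC a, ∑ e ∈ nAD a ∩ nCD c, (nCB c ∩ nDB e).card) + (∑ a, ∑ b ∈ nAB a, ∑ e ∈ nAD a ∩ nBD b, (nBC b ∩ nDC e).card)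
         + (∑ a, ∑ b ∈ nAB a, ∑ c ∈ nAC a ∩ nBC b, (nBD b ∩ nCD c).card) + (∑ a, ∑ b ∈ nAB a, ∑ c ∈ nAC a, (nAD a ∩ nBD b ∩ nCD c).card)
         + (∑ a, ∑ b ∈ nAB a, ∑ c ∈ nAC a ∩ nBC b, (nAD a ∩ nCD c).card) + (∑ a, ∑ b ∈ nAB a, ∑ _c ∈ nAC a ∩ nBC b, (nAD a ∩ nBD b).card))
    ≤ 2 * ((∑ a, ∑ b ∈ nAB a, ∑ e ∈ nAD a, (nBC b ∩ nDC e).card) + (∑ a, ∑ b ∈ nAB a, ∑ c ∈ nAC a, (nBD b ∩ nCD c).card)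
         + (∑ a, ∑ c ∈ nAC a, ∑ e ∈ nAD a, (nCB c ∩ nDB e).card))
      + 3 * m ^ 2
      + ((∑ a, μA a * ∑ b ∈ nAB a, (nAC a ∩ nBC b).card) + (∑ a, ∑ b ∈ nAB a, ∑ _c ∈ nAC a ∩ nBC b, μB b) + (∑ a, ∑ b ∈ nAB a, ∑ c ∈ nAC a ∩ nBC b, μC c)
         + (∑ a, μA a * ∑ b ∈ nAB a, (nAD a ∩ nBD b).card) + (∑ a, ∑ b ∈ nAB a, ∑ _e ∈ nAD a ∩ nBD b, μB b) + (∑ a, ∑ b ∈ nAB a, ∑ e ∈ nAD a ∩ nBD b, μD e)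
         + (∑ a, μA a * ∑ c ∈ nAC a, (nAD a ∩ nCD c).card) + (∑ a, ∑ c ∈ nAC a, ∑ _e ∈ nAD a ∩ nCD c, μC c) + (∑ a, ∑ c ∈ nAC a, ∑ e ∈ nAD a ∩ nCD c, μD e)
         + (∑ b, μB b * ∑ c ∈ nBC b, (nBD b ∩ nCD c).card) + (∑ c, μC c * ∑ b ∈ nCB c, (nBD b ∩ nCD c).card) + (∑ e, μD e * ∑ b ∈ nDB e, (nBC b ∩ nDC e).card))
      + 3 * (∑ a, ∑ b ∈ nAB a, ∑ c ∈ nAC a ∩ nBC b, (nAD a ∩ nBD b ∩ nCD c).card) := by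
  classical
  -- matching {AB, CD}: boxes in C × D over the AB-tori (S₁ = nAC a, S₂ = nBC b; K₁ = nAD a, K₂ = nBD b)
  have key₁ : ∀ a, ∀ b ∈ nAB a,
      (∑ c ∈ nAC a, μC c) + (∑ c ∈ nBC b, μC c) + (∑ e ∈ nAD a, μD e) + (∑ e ∈ nBD b, μD e)
        + (∑ c ∈ nAC a, (nAD a ∩ nBD b ∩ nCD c).card) + (∑ e ∈ nAD a ∩ nBD b, (nBC b ∩ nDC e).card)
        + (∑ c ∈ nAC a ∩ nBC b, (nAD a ∩ nCD c).card) + (∑ c ∈ nAC a ∩ nBC b, (nBD b ∩ nCD c).card)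
      ≤ (∑ e ∈ nAD a, (nBC b ∩ nDC e).card) + (∑ c ∈ nAC a, (nBD b ∩ nCD c).card)
        + (∑ c ∈ nAC a, (nAD a ∩ nCD c).card) + (∑ c ∈ nBC b, (nBD b ∩ nCD c).card)
        + (∑ c ∈ nAC a ∩ nBC b, (nAD a ∩ nBD b ∩ nCD c).card)
        + (∑ c ∈ nAC a ∩ nBC b, μC c) + (∑ e ∈ nAD a ∩ nBD b, μD e) + m := by
    intro a b hb
    have hbox := box_bound_overlap_margins m μC μD nCD nDC cCD rCD rDC mD (nAC a) (nBC b) (nAD a) (nBD b)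
    have e1 : ∑ c ∈ nBC b, (nCD c ∩ nAD a).card = ∑ e ∈ nAD a, (nBC b ∩ nDC e).card := by
      rw [sum_card_inter_comm (nBC b) (nAD a) nCD nDC cCD]; exact Finset.sum_congr rfl (fun e _ => by rw [Finset.inter_comm])
    have e2 : ∑ c ∈ nAC a, (nCD c ∩ nBD b).card = ∑ c ∈ nAC a, (nBD b ∩ nCD c).card := Finset.sum_congr rfl (fun c _ => by rw [Finset.inter_comm])
    have e3 : ∑ c ∈ nAC a, (nCD c ∩ nAD a).card = ∑ c ∈ nAC a, (nAD a ∩ nCD c).card := Finset.sum_congr rfl (fun c _ => by rw [Finset.inter_comm])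
    have e4 : ∑ c ∈ nBC b, (nCD c ∩ nBD b).card = ∑ c ∈ nBC b, (nBD b ∩ nCD c).card := Finset.sum_congr rfl (fun c _ => by rw [Finset.inter_comm])
    have e5 : ∑ c ∈ nAC a, (nCD c ∩ (nAD a ∩ nBD b)).card = ∑ c ∈ nAC a, (nAD a ∩ nBD b ∩ nCD c).card := Finset.sum_congr rfl (fun c _ => by rw [Finset.inter_comm])
    have e6 : ∑ c ∈ nBC b, (nCD c ∩ (nAD a ∩ nBD b)).card = ∑ e ∈ nAD a ∩ nBD b, (nBC b ∩ nDC e).card := by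
      rw [sum_card_inter_comm (nBC b) (nAD a ∩ nBD b) nCD nDC cCD]; exact Finset.sum_congr rfl (fun e _ => by rw [Finset.inter_comm])
    have e7 : ∑ c ∈ nAC a ∩ nBC b, (nCD c ∩ nAD a).card = ∑ c ∈ nAC a ∩ nBC b, (nAD a ∩ nCD c).card := Finset.sum_congr rfl (fun c _ => by rw [Finset.inter_comm])
    have e8 : ∑ c ∈ nAC a ∩ nBC b, (nCD c ∩ nBD b).card = ∑ c ∈ nAC a ∩ nBC b, (nBD b ∩ nCD c).card := Finset.sum_congr rfl (fun c _ => by rw [Finset.inter_comm])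
    have e9 : ∑ c ∈ nAC a ∩ nBC b, (nCD c ∩ (nAD a ∩ nBD b)).card = ∑ c ∈ nAC a ∩ nBC b, (nAD a ∩ nBD b ∩ nCD c).card := Finset.sum_congr rfl (fun c _ => by rw [Finset.inter_comm])
    rw [e1, e2, e3, e4, e5, e6, e7, e8, e9] at hbox; linarith
  have m₁ : (∑ a, μA a * ∑ c ∈ nAC a, μC c) + (∑ b, μB b * ∑ c ∈ nBC b, μC c) + (∑ a, μA a * ∑ e ∈ nAD a, μD e) + (∑ b, μB b * ∑ e ∈ nBD b, μD e)
      + (∑ a, ∑ b ∈ nAB a, ∑ c ∈ nAC a, (nAD a ∩ nBD b ∩ nCD c).card) + (∑ a, ∑ b ∈ nAB a, ∑ e ∈ nAD a ∩ nBD b, (nBC b ∩ nDC e).card)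
      + (∑ a, ∑ b ∈ nAB a, ∑ c ∈ nAC a ∩ nBC b, (nAD a ∩ nCD c).card) + (∑ a, ∑ b ∈ nAB a, ∑ c ∈ nAC a ∩ nBC b, (nBD b ∩ nCD c).card)
      ≤ (∑ a, ∑ b ∈ nAB a, ∑ e ∈ nAD a, (nBC b ∩ nDC e).card) + (∑ a, ∑ b ∈ nAB a, ∑ c ∈ nAC a, (nBD b ∩ nCD c).card)
        + (∑ a, μA a * ∑ c ∈ nAC a, (nAD a ∩ nCD c).card) + (∑ b, μB b * ∑ c ∈ nBC b, (nBD b ∩ nCD c).card)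
        + (∑ a, ∑ b ∈ nAB a, ∑ c ∈ nAC a ∩ nBC b, (nAD a ∩ nBD b ∩ nCD c).card)
        + (∑ a, ∑ b ∈ nAB a, ∑ c ∈ nAC a ∩ nBC b, μC c) + (∑ a, ∑ b ∈ nAB a, ∑ e ∈ nAD a ∩ nBD b, μD e) + m * m := by
    have hsum := Finset.sum_le_sum (s := (univ : Finset α)) (fun a _ => Finset.sum_le_sum (fun b hb => key₁ a b hb))
    have lhs : ∑ a ∈ (univ : Finset α), ∑ b ∈ nAB a,
        ((∑ c ∈ nAC a, μC c) + (∑ c ∈ nBC b, μC c) + (∑ e ∈ nAD a, μD e) + (∑ e ∈ nBD b, μD e)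
          + (∑ c ∈ nAC a, (nAD a ∩ nBD b ∩ nCD c).card) + (∑ e ∈ nAD a ∩ nBD b, (nBC b ∩ nDC e).card)
          + (∑ c ∈ nAC a ∩ nBC b, (nAD a ∩ nCD c).card) + (∑ c ∈ nAC a ∩ nBC b, (nBD b ∩ nCD c).card))
        = (∑ a, μA a * ∑ c ∈ nAC a, μC c) + (∑ b, μB b * ∑ c ∈ nBC b, μC c) + (∑ a, μA a * ∑ e ∈ nAD a, μD e) + (∑ b, μB b * ∑ e ∈ nBD b, μD e)
          + (∑ a, ∑ b ∈ nAB a, ∑ c ∈ nAC a, (nAD a ∩ nBD b ∩ nCD c).card) + (∑ a, ∑ b ∈ nAB a, ∑ e ∈ nAD a ∩ nBD b, (nBC b ∩ nDC e).card)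
          + (∑ a, ∑ b ∈ nAB a, ∑ c ∈ nAC a ∩ nBC b, (nAD a ∩ nCD c).card) + (∑ a, ∑ b ∈ nAB a, ∑ c ∈ nAC a ∩ nBC b, (nBD b ∩ nCD c).card) := by
      simp only [Finset.sum_add_distrib, Finset.sum_const, smul_eq_mul, rAB]
      rw [edge_sum_comm nAB nBA cAB (fun b => ∑ c ∈ nBC b, μC c), edge_sum_comm nAB nBA cAB (fun b => ∑ e ∈ nBD b, μD e)]
      simp only [rBA]
    have rhs : ∑ a ∈ (univ : Finset α), ∑ b ∈ nAB a,
        ((∑ e ∈ nAD a, (nBC b ∩ nDC e).card) + (∑ c ∈ nAC a, (nBD b ∩ nCD c).card)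
          + (∑ c ∈ nAC a, (nAD a ∩ nCD c).card) + (∑ c ∈ nBC b, (nBD b ∩ nCD c).card)
          + (∑ c ∈ nAC a ∩ nBC b, (nAD a ∩ nBD b ∩ nCD c).card)
          + (∑ c ∈ nAC a ∩ nBC b, μC c) + (∑ e ∈ nAD a ∩ nBD b, μD e) + m)
        = (∑ a, ∑ b ∈ nAB a, ∑ e ∈ nAD a, (nBC b ∩ nDC e).card) + (∑ a, ∑ b ∈ nAB a, ∑ c ∈ nAC a, (nBD b ∩ nCD c).card)
          + (∑ a, μA a * ∑ c ∈ nAC a, (nAD a ∩ nCD c).card) + (∑ b, μB b * ∑ c ∈ nBC b, (nBD b ∩ nCD c).card)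
          + (∑ a, ∑ b ∈ nAB a, ∑ c ∈ nAC a ∩ nBC b, (nAD a ∩ nBD b ∩ nCD c).card)
          + (∑ a, ∑ b ∈ nAB a, ∑ c ∈ nAC a ∩ nBC b, μC c) + (∑ a, ∑ b ∈ nAB a, ∑ e ∈ nAD a ∩ nBD b, μD e) + m * m := by
      simp only [Finset.sum_add_distrib, Finset.sum_const, smul_eq_mul, rAB]
      rw [edge_sum_comm nAB nBA cAB (fun b => ∑ c ∈ nBC b, (nBD b ∩ nCD c).card), ← Finset.sum_mul, mA]
      simp only [rBA]
    rw [lhs, rhs] at hsum; exact hsum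
  -- matching {AC, BD}: boxes in B × D over the AC-tori (S₁ = nAB a, S₂ = nCB c; K₁ = nAD a, K₂ = nCD c)
  have key₂ : ∀ a, ∀ c ∈ nAC a,
      (∑ b ∈ nAB a, μB b) + (∑ b ∈ nCB c, μB b) + (∑ e ∈ nAD a, μD e) + (∑ e ∈ nCD c, μD e)
        + (∑ b ∈ nAB a, (nAD a ∩ nBD b ∩ nCD c).card) + (∑ e ∈ nAD a ∩ nCD c, (nCB c ∩ nDB e).card)
        + (∑ b ∈ nAB a ∩ nCB c, (nAD a ∩ nBD b).card) + (∑ b ∈ nAB a ∩ nCB c, (nBD b ∩ nCD c).card)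
      ≤ (∑ e ∈ nAD a, (nCB c ∩ nDB e).card) + (∑ b ∈ nAB a, (nBD b ∩ nCD c).card)
        + (∑ b ∈ nAB a, (nAD a ∩ nBD b).card) + (∑ b ∈ nCB c, (nBD b ∩ nCD c).card)
        + (∑ b ∈ nAB a ∩ nCB c, (nAD a ∩ nBD b ∩ nCD c).card)
        + (∑ b ∈ nAB a ∩ nCB c, μB b) + (∑ e ∈ nAD a ∩ nCD c, μD e) + m := by
    intro a c hc
    have hbox := box_bound_overlap_margins m μB μD nBD nDB cBD rBD rDB mD (nAB a) (nCB c) (nAD a) (nCD c)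
    have e1 : ∑ b ∈ nCB c, (nBD b ∩ nAD a).card = ∑ e ∈ nAD a, (nCB c ∩ nDB e).card := by
      rw [sum_card_inter_comm (nCB c) (nAD a) nBD nDB cBD]; exact Finset.sum_congr rfl (fun e _ => by rw [Finset.inter_comm])
    have e3 : ∑ b ∈ nAB a, (nBD b ∩ nAD a).card = ∑ b ∈ nAB a, (nAD a ∩ nBD b).card := Finset.sum_congr rfl (fun b _ => by rw [Finset.inter_comm])
    have e5 : ∑ b ∈ nAB a, (nBD b ∩ (nAD a ∩ nCD c)).card = ∑ b ∈ nAB a, (nAD a ∩ nBD b ∩ nCD c).card :=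
      Finset.sum_congr rfl (fun b _ => by congr 1; ext e; simp only [Finset.mem_inter]; tauto)
    have e6 : ∑ b ∈ nCB c, (nBD b ∩ (nAD a ∩ nCD c)).card = ∑ e ∈ nAD a ∩ nCD c, (nCB c ∩ nDB e).card := by
      rw [sum_card_inter_comm (nCB c) (nAD a ∩ nCD c) nBD nDB cBD]; exact Finset.sum_congr rfl (fun e _ => by rw [Finset.inter_comm])
    have e7 : ∑ b ∈ nAB a ∩ nCB c, (nBD b ∩ nAD a).card = ∑ b ∈ nAB a ∩ nCB c, (nAD a ∩ nBD b).card := Finset.sum_congr rfl (fun b _ => by rw [Finset.inter_comm])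
    have e9 : ∑ b ∈ nAB a ∩ nCB c, (nBD b ∩ (nAD a ∩ nCD c)).card = ∑ b ∈ nAB a ∩ nCB c, (nAD a ∩ nBD b ∩ nCD c).card :=
      Finset.sum_congr rfl (fun b _ => by congr 1; ext e; simp only [Finset.mem_inter]; tauto)
    rw [e1, e3, e5, e6, e7, e9] at hbox; linarith
  have m₂ : (∑ a, μA a * ∑ b ∈ nAB a, μB b) + (∑ b, μB b * ∑ c ∈ nBC b, μC c) + (∑ a, μA a * ∑ e ∈ nAD a, μD e) + (∑ c, μC c * ∑ e ∈ nCD c, μD e)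
      + (∑ a, ∑ b ∈ nAB a, ∑ c ∈ nAC a, (nAD a ∩ nBD b ∩ nCD c).card) + (∑ a, ∑ c ∈ nAC a, ∑ e ∈ nAD a ∩ nCD c, (nCB c ∩ nDB e).card)
      + (∑ a, ∑ b ∈ nAB a, ∑ _c ∈ nAC a ∩ nBC b, (nAD a ∩ nBD b).card) + (∑ a, ∑ b ∈ nAB a, ∑ c ∈ nAC a ∩ nBC b, (nBD b ∩ nCD c).card)
      ≤ (∑ a, ∑ c ∈ nAC a, ∑ e ∈ nAD a, (nCB c ∩ nDB e).card) + (∑ a, ∑ b ∈ nAB a, ∑ c ∈ nAC a, (nBD b ∩ nCD c).card)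
        + (∑ a, μA a * ∑ b ∈ nAB a, (nAD a ∩ nBD b).card) + (∑ c, μC c * ∑ b ∈ nCB c, (nBD b ∩ nCD c).card)
        + (∑ a, ∑ b ∈ nAB a, ∑ c ∈ nAC a ∩ nBC b, (nAD a ∩ nBD b ∩ nCD c).card)
        + (∑ a, ∑ b ∈ nAB a, ∑ c ∈ nAC a ∩ nBC b, μB b) + (∑ a, ∑ c ∈ nAC a, ∑ e ∈ nAD a ∩ nCD c, μD e) + m * m := by
    have hsum := Finset.sum_le_sum (s := (univ : Finset α)) (fun a _ => Finset.sum_le_sum (fun c hc => key₂ a c hc))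
    have cv1 : ∀ a : α, ∑ c ∈ nAC a, ∑ b ∈ nAB a, (nAD a ∩ nBD b ∩ nCD c).card = ∑ b ∈ nAB a, ∑ c ∈ nAC a, (nAD a ∩ nBD b ∩ nCD c).card := fun a => Finset.sum_comm
    have cv2 : ∀ a : α, ∑ c ∈ nAC a, ∑ b ∈ nAB a ∩ nCB c, (nAD a ∩ nBD b).card = ∑ b ∈ nAB a, ∑ c ∈ nAC a ∩ nBC b, (nAD a ∩ nBD b).card := fun a =>
      sum_inter_comm (nAC a) (nAB a) nCB nBC (fun c b => (cBC b c).symm) _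
    have cv3 : ∀ a : α, ∑ c ∈ nAC a, ∑ b ∈ nAB a ∩ nCB c, (nBD b ∩ nCD c).card = ∑ b ∈ nAB a, ∑ c ∈ nAC a ∩ nBC b, (nBD b ∩ nCD c).card := fun a =>
      sum_inter_comm (nAC a) (nAB a) nCB nBC (fun c b => (cBC b c).symm) _
    have cv4 : ∀ a : α, ∑ c ∈ nAC a, ∑ b ∈ nAB a, (nBD b ∩ nCD c).card = ∑ b ∈ nAB a, ∑ c ∈ nAC a, (nBD b ∩ nCD c).card := fun a => Finset.sum_comm
    have cv5 : ∀ a : α, ∑ c ∈ nAC a, ∑ b ∈ nAB a ∩ nCB c, (nAD a ∩ nBD b ∩ nCD c).card = ∑ b ∈ nAB a, ∑ c ∈ nAC a ∩ nBC b, (nAD a ∩ nBD b ∩ nCD c).card := fun a =>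
      sum_inter_comm (nAC a) (nAB a) nCB nBC (fun c b => (cBC b c).symm) _
    have cv6 : ∀ a : α, ∑ c ∈ nAC a, ∑ b ∈ nAB a ∩ nCB c, μB b = ∑ b ∈ nAB a, ∑ c ∈ nAC a ∩ nBC b, μB b := fun a =>
      sum_inter_comm (nAC a) (nAB a) nCB nBC (fun c b => (cBC b c).symm) _
    have lhs : ∑ a ∈ (univ : Finset α), ∑ c ∈ nAC a,
        ((∑ b ∈ nAB a, μB b) + (∑ b ∈ nCB c, μB b) + (∑ e ∈ nAD a, μD e) + (∑ e ∈ nCD c, μD e)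
          + (∑ b ∈ nAB a, (nAD a ∩ nBD b ∩ nCD c).card) + (∑ e ∈ nAD a ∩ nCD c, (nCB c ∩ nDB e).card)
          + (∑ b ∈ nAB a ∩ nCB c, (nAD a ∩ nBD b).card) + (∑ b ∈ nAB a ∩ nCB c, (nBD b ∩ nCD c).card))
        = (∑ a, μA a * ∑ b ∈ nAB a, μB b) + (∑ b, μB b * ∑ c ∈ nBC b, μC c) + (∑ a, μA a * ∑ e ∈ nAD a, μD e) + (∑ c, μC c * ∑ e ∈ nCD c, μD e)
          + (∑ a, ∑ b ∈ nAB a, ∑ c ∈ nAC a, (nAD a ∩ nBD b ∩ nCD c).card) + (∑ a, ∑ c ∈ nAC a, ∑ e ∈ nAD a ∩ nCD c, (nCB c ∩ nDB e).card)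
          + (∑ a, ∑ b ∈ nAB a, ∑ _c ∈ nAC a ∩ nBC b, (nAD a ∩ nBD b).card) + (∑ a, ∑ b ∈ nAB a, ∑ c ∈ nAC a ∩ nBC b, (nBD b ∩ nCD c).card) := by
      simp only [Finset.sum_add_distrib, Finset.sum_const, smul_eq_mul, rAC, cv1, cv2, cv3]
      rw [edge_sum_comm nAC nCA cAC (fun c => ∑ b ∈ nCB c, μB b), edge_sum_comm nAC nCA cAC (fun c => ∑ e ∈ nCD c, μD e)]
      simp only [rCA]
      rw [B_symm μC μB nCB nBC (fun c b => (cBC b c).symm)]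
    have rhs : ∑ a ∈ (univ : Finset α), ∑ c ∈ nAC a,
        ((∑ e ∈ nAD a, (nCB c ∩ nDB e).card) + (∑ b ∈ nAB a, (nBD b ∩ nCD c).card)
          + (∑ b ∈ nAB a, (nAD a ∩ nBD b).card) + (∑ b ∈ nCB c, (nBD b ∩ nCD c).card)
          + (∑ b ∈ nAB a ∩ nCB c, (nAD a ∩ nBD b ∩ nCD c).card)
          + (∑ b ∈ nAB a ∩ nCB c, μB b) + (∑ e ∈ nAD a ∩ nCD c, μD e) + m)
        = (∑ a, ∑ c ∈ nAC a, ∑ e ∈ nAD a, (nCB c ∩ nDB e).card) + (∑ a, ∑ b ∈ nAB a, ∑ c ∈ nAC a, (nBD b ∩ nCD c).card)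
          + (∑ a, μA a * ∑ b ∈ nAB a, (nAD a ∩ nBD b).card) + (∑ c, μC c * ∑ b ∈ nCB c, (nBD b ∩ nCD c).card)
          + (∑ a, ∑ b ∈ nAB a, ∑ c ∈ nAC a ∩ nBC b, (nAD a ∩ nBD b ∩ nCD c).card)
          + (∑ a, ∑ b ∈ nAB a, ∑ c ∈ nAC a ∩ nBC b, μB b) + (∑ a, ∑ c ∈ nAC a, ∑ e ∈ nAD a ∩ nCD c, μD e) + m * m := by
      simp only [Finset.sum_add_distrib, Finset.sum_const, smul_eq_mul, rAC, cv4, cv5, cv6]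
      rw [edge_sum_comm nAC nCA cAC (fun c => ∑ b ∈ nCB c, (nBD b ∩ nCD c).card), ← Finset.sum_mul, mA]
      simp only [rCA]
    rw [lhs, rhs] at hsum; exact hsum
  -- matching {AD, BC}: boxes in B × C over the AD-tori (S₁ = nAB a, S₂ = nDB e; K₁ = nAC a, K₂ = nDC e)
  have key₃ : ∀ a, ∀ e ∈ nAD a,
      (∑ b ∈ nAB a, μB b) + (∑ b ∈ nDB e, μB b) + (∑ c ∈ nAC a, μC c) + (∑ c ∈ nDC e, μC c)
        + (∑ b ∈ nAB a, (nBC b ∩ (nAC a ∩ nDC e)).card) + (∑ c ∈ nAC a ∩ nDC e, (nCB c ∩ nDB e).card)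
        + (∑ b ∈ nAB a ∩ nDB e, (nBC b ∩ nAC a).card) + (∑ b ∈ nAB a ∩ nDB e, (nBC b ∩ nDC e).card)
      ≤ (∑ c ∈ nAC a, (nCB c ∩ nDB e).card) + (∑ b ∈ nAB a, (nBC b ∩ nDC e).card)
        + (∑ b ∈ nAB a, (nAC a ∩ nBC b).card) + (∑ b ∈ nDB e, (nBC b ∩ nDC e).card)
        + (∑ b ∈ nAB a ∩ nDB e, (nBC b ∩ (nAC a ∩ nDC e)).card)
        + (∑ b ∈ nAB a ∩ nDB e, μB b) + (∑ c ∈ nAC a ∩ nDC e, μC c) + m := by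
    intro a e he
    have hbox := box_bound_overlap_margins m μB μC nBC nCB cBC rBC rCB mC (nAB a) (nDB e) (nAC a) (nDC e)
    have e1 : ∑ b ∈ nDB e, (nBC b ∩ nAC a).card = ∑ c ∈ nAC a, (nCB c ∩ nDB e).card := by rw [sum_card_inter_comm (nDB e) (nAC a) nBC nCB cBC]
    have e3 : ∑ b ∈ nAB a, (nBC b ∩ nAC a).card = ∑ b ∈ nAB a, (nAC a ∩ nBC b).card := Finset.sum_congr rfl (fun b _ => by rw [Finset.inter_comm])
    have e6 : ∑ b ∈ nDB e, (nBC b ∩ (nAC a ∩ nDC e)).card = ∑ c ∈ nAC a ∩ nDC e, (nCB c ∩ nDB e).card := by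
      rw [sum_card_inter_comm (nDB e) (nAC a ∩ nDC e) nBC nCB cBC]
    rw [e1, e3, e6] at hbox; linarith
  have m₃ : (∑ a, μA a * ∑ b ∈ nAB a, μB b) + (∑ b, μB b * ∑ e ∈ nBD b, μD e) + (∑ a, μA a * ∑ c ∈ nAC a, μC c) + (∑ c, μC c * ∑ e ∈ nCD c, μD e)
      + (∑ a, ∑ b ∈ nAB a, ∑ c ∈ nAC a ∩ nBC b, (nAD a ∩ nCD c).card) + (∑ a, ∑ c ∈ nAC a, ∑ e ∈ nAD a ∩ nCD c, (nCB c ∩ nDB e).card)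
      + (∑ a, ∑ b ∈ nAB a, ∑ _c ∈ nAC a ∩ nBC b, (nAD a ∩ nBD b).card) + (∑ a, ∑ b ∈ nAB a, ∑ e ∈ nAD a ∩ nBD b, (nBC b ∩ nDC e).card)
      ≤ (∑ a, ∑ c ∈ nAC a, ∑ e ∈ nAD a, (nCB c ∩ nDB e).card) + (∑ a, ∑ b ∈ nAB a, ∑ e ∈ nAD a, (nBC b ∩ nDC e).card)
        + (∑ a, μA a * ∑ b ∈ nAB a, (nAC a ∩ nBC b).card) + (∑ e, μD e * ∑ b ∈ nDB e, (nBC b ∩ nDC e).card)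
        + (∑ a, ∑ b ∈ nAB a, ∑ c ∈ nAC a ∩ nBC b, (nAD a ∩ nBD b ∩ nCD c).card)
        + (∑ a, ∑ b ∈ nAB a, ∑ e ∈ nAD a ∩ nBD b, μB b) + (∑ a, ∑ c ∈ nAC a, ∑ e ∈ nAD a ∩ nCD c, μC c) + m * m := by
    have hsum := Finset.sum_le_sum (s := (univ : Finset α)) (fun a _ => Finset.sum_le_sum (fun e he => key₃ a e he))
    have cv1 : ∀ a : α, ∑ e ∈ nAD a, ∑ b ∈ nAB a, (nBC b ∩ (nAC a ∩ nDC e)).card = ∑ b ∈ nAB a, ∑ c ∈ nAC a ∩ nBC b, (nAD a ∩ nCD c).card := by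
      intro a; rw [Finset.sum_comm]
      refine Finset.sum_congr rfl (fun b _ => ?_)
      have h' : ∀ e, nBC b ∩ (nAC a ∩ nDC e) = nDC e ∩ (nAC a ∩ nBC b) := by intro e; ext c; simp only [Finset.mem_inter]; tauto
      simp_rw [h']
      rw [sum_card_inter_comm (nAD a) (nAC a ∩ nBC b) nDC nCD (fun e c => (cCD c e).symm)]
      exact Finset.sum_congr rfl (fun c _ => by rw [Finset.inter_comm])
    have cv2 : ∀ a : α, ∑ e ∈ nAD a, ∑ c ∈ nAC a ∩ nDC e, (nCB c ∩ nDB e).card = ∑ c ∈ nAC a, ∑ e ∈ nAD a ∩ nCD c, (nCB c ∩ nDB e).card := fun a =>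
      sum_inter_comm (nAD a) (nAC a) nDC nCD (fun e c => (cCD c e).symm) _
    have cv3 : ∀ a : α, ∑ e ∈ nAD a, ∑ b ∈ nAB a ∩ nDB e, (nBC b ∩ nAC a).card = ∑ b ∈ nAB a, ∑ _c ∈ nAC a ∩ nBC b, (nAD a ∩ nBD b).card := by
      intro a; rw [sum_inter_comm (nAD a) (nAB a) nDB nBD (fun e b => (cBD b e).symm)]
      refine Finset.sum_congr rfl (fun b _ => ?_)
      rw [Finset.sum_const, Finset.sum_const, smul_eq_mul, smul_eq_mul, Finset.inter_comm (nBC b)]; ring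
    have cv4 : ∀ a : α, ∑ e ∈ nAD a, ∑ b ∈ nAB a ∩ nDB e, (nBC b ∩ nDC e).card = ∑ b ∈ nAB a, ∑ e ∈ nAD a ∩ nBD b, (nBC b ∩ nDC e).card := fun a =>
      sum_inter_comm (nAD a) (nAB a) nDB nBD (fun e b => (cBD b e).symm) _
    have cv5 : ∀ a : α, ∑ e ∈ nAD a, ∑ c ∈ nAC a, (nCB c ∩ nDB e).card = ∑ c ∈ nAC a, ∑ e ∈ nAD a, (nCB c ∩ nDB e).card := fun a => Finset.sum_comm
    have cv6 : ∀ a : α, ∑ e ∈ nAD a, ∑ b ∈ nAB a, (nBC b ∩ nDC e).card = ∑ b ∈ nAB a, ∑ e ∈ nAD a, (nBC b ∩ nDC e).card := fun a => Finset.sum_comm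
    have cv7 : ∀ a : α, ∑ e ∈ nAD a, ∑ b ∈ nAB a ∩ nDB e, (nBC b ∩ (nAC a ∩ nDC e)).card = ∑ b ∈ nAB a, ∑ c ∈ nAC a ∩ nBC b, (nAD a ∩ nBD b ∩ nCD c).card := by
      intro a; rw [sum_inter_comm (nAD a) (nAB a) nDB nBD (fun e b => (cBD b e).symm)]
      refine Finset.sum_congr rfl (fun b _ => ?_)
      have h' : ∀ e, nBC b ∩ (nAC a ∩ nDC e) = nDC e ∩ (nAC a ∩ nBC b) := by intro e; ext c; simp only [Finset.mem_inter]; tauto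
      simp_rw [h']
      rw [sum_card_inter_comm (nAD a ∩ nBD b) (nAC a ∩ nBC b) nDC nCD (fun e c => (cCD c e).symm)]
      exact Finset.sum_congr rfl (fun c _ => by rw [Finset.inter_comm])
    have cv8 : ∀ a : α, ∑ e ∈ nAD a, ∑ b ∈ nAB a ∩ nDB e, μB b = ∑ b ∈ nAB a, ∑ e ∈ nAD a ∩ nBD b, μB b := fun a =>
      sum_inter_comm (nAD a) (nAB a) nDB nBD (fun e b => (cBD b e).symm) _
    have cv9 : ∀ a : α, ∑ e ∈ nAD a, ∑ c ∈ nAC a ∩ nDC e, μC c = ∑ c ∈ nAC a, ∑ e ∈ nAD a ∩ nCD c, μC c := fun a =>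
      sum_inter_comm (nAD a) (nAC a) nDC nCD (fun e c => (cCD c e).symm) _
    have lhs : ∑ a ∈ (univ : Finset α), ∑ e ∈ nAD a,
        ((∑ b ∈ nAB a, μB b) + (∑ b ∈ nDB e, μB b) + (∑ c ∈ nAC a, μC c) + (∑ c ∈ nDC e, μC c)
          + (∑ b ∈ nAB a, (nBC b ∩ (nAC a ∩ nDC e)).card) + (∑ c ∈ nAC a ∩ nDC e, (nCB c ∩ nDB e).card)
          + (∑ b ∈ nAB a ∩ nDB e, (nBC b ∩ nAC a).card) + (∑ b ∈ nAB a ∩ nDB e, (nBC b ∩ nDC e).card))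
        = (∑ a, μA a * ∑ b ∈ nAB a, μB b) + (∑ b, μB b * ∑ e ∈ nBD b, μD e) + (∑ a, μA a * ∑ c ∈ nAC a, μC c) + (∑ c, μC c * ∑ e ∈ nCD c, μD e)
          + (∑ a, ∑ b ∈ nAB a, ∑ c ∈ nAC a ∩ nBC b, (nAD a ∩ nCD c).card) + (∑ a, ∑ c ∈ nAC a, ∑ e ∈ nAD a ∩ nCD c, (nCB c ∩ nDB e).card)
          + (∑ a, ∑ b ∈ nAB a, ∑ _c ∈ nAC a ∩ nBC b, (nAD a ∩ nBD b).card) + (∑ a, ∑ b ∈ nAB a, ∑ e ∈ nAD a ∩ nBD b, (nBC b ∩ nDC e).card) := by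
      simp only [Finset.sum_add_distrib, Finset.sum_const, smul_eq_mul, rAD, cv1, cv2, cv3, cv4]
      rw [edge_sum_comm nAD nDA cAD (fun e => ∑ b ∈ nDB e, μB b), edge_sum_comm nAD nDA cAD (fun e => ∑ c ∈ nDC e, μC c)]
      simp only [rDA]
      rw [B_symm μD μB nDB nBD (fun e b => (cBD b e).symm), B_symm μD μC nDC nCD (fun e c => (cCD c e).symm)]
    have rhs : ∑ a ∈ (univ : Finset α), ∑ e ∈ nAD a,
        ((∑ c ∈ nAC a, (nCB c ∩ nDB e).card) + (∑ b ∈ nAB a, (nBC b ∩ nDC e).card)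
          + (∑ b ∈ nAB a, (nAC a ∩ nBC b).card) + (∑ b ∈ nDB e, (nBC b ∩ nDC e).card)
          + (∑ b ∈ nAB a ∩ nDB e, (nBC b ∩ (nAC a ∩ nDC e)).card)
          + (∑ b ∈ nAB a ∩ nDB e, μB b) + (∑ c ∈ nAC a ∩ nDC e, μC c) + m)
        = (∑ a, ∑ c ∈ nAC a, ∑ e ∈ nAD a, (nCB c ∩ nDB e).card) + (∑ a, ∑ b ∈ nAB a, ∑ e ∈ nAD a, (nBC b ∩ nDC e).card)
          + (∑ a, μA a * ∑ b ∈ nAB a, (nAC a ∩ nBC b).card) + (∑ e, μD e * ∑ b ∈ nDB e, (nBC b ∩ nDC e).card)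
          + (∑ a, ∑ b ∈ nAB a, ∑ c ∈ nAC a ∩ nBC b, (nAD a ∩ nBD b ∩ nCD c).card)
          + (∑ a, ∑ b ∈ nAB a, ∑ e ∈ nAD a ∩ nBD b, μB b) + (∑ a, ∑ c ∈ nAC a, ∑ e ∈ nAD a ∩ nCD c, μC c) + m * m := by
      simp only [Finset.sum_add_distrib, Finset.sum_const, smul_eq_mul, rAD, cv5, cv6, cv7, cv8, cv9]
      rw [edge_sum_comm nAD nDA cAD (fun e => ∑ b ∈ nDB e, (nBC b ∩ nDC e).card), ← Finset.sum_mul, mA]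
      simp only [rDA]
    rw [lhs, rhs] at hsum; exact hsum
  nlinarith [m₁, m₂, m₃]

end Design

end FourCoordinateBoxMaster

end Summit.Ventures.HSemireg
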